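import Summits.CriticalPhenomena.SAWScalingLimit.Theorems.SAWDevelopingMapHexConjectureWindowFloorData
import HarnessLib

/-!
# Crux `HexConjecture` (stmt-CriticalPhenomena-0808), line `root-locality-replaces-loewner`:
one dyadic block of the floor window already carries `M/δ`

Landing target:
`Summits/CriticalPhenomena/SAWScalingLimit/Theorems/SAWDevelopingMapHexConjectureWindowBlockSum.lean`
(`--supports stmt-CriticalPhenomena-0808`; lead continuation prover-line-stmt-CriticalPhenomena-0808-c6-0).

In the c6 reshape of the bootstrap the window mass `Σ_{d : θ₁ρ₂/δ ≤ d ≤ θ₀ρ₂/δ} Z_{Λδ}(a → t_d)` is compared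
with `Z(a,b) · Σ_d G(δ d)`, where the floor-ratio profile satisfies `G(t) ≥ κ t^{-5/4}` (simple pole of the
half-plane map at the root, exponent `5/8`).  `window_block_sum_ge` is the elementary real-analysis fact
that makes the window gain unbounded as `θ₁ → 0⁺`: for every `M > 0` there is `θ₁ > 0` with `2θ₁ < θ₀` such
that, eventually along `δ → 0⁺`, any finite set `S ⊇ {d ∈ ℤ : θ₁ρ₂/δ ≤ d ≤ 2θ₁ρ₂/δ}` and any `g ≥ 0` on `S`
with `g d ≥ κ (δ d)^{-5/4}` on that dyadic block satisfy `Σ_S g ≥ M/δ`.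
Proof: put `u = 2θ₁ρ₂`, `R = ρ₂/δ`.  The block `B = Icc ⌈θ₁R⌉ ⌊2θ₁R⌋ ⊆ S` has
`#B ≥ ⌊2θ₁R⌋ + 1 - ⌈θ₁R⌉ ≥ θ₁R - 1 = u/(2δ) - 1` points (`Int.card_Icc`); on it `0 < δ d ≤ u`, so
`(δ d)^{-5/4} ≥ u^{-5/4}` (antitone base for a negative exponent) and every term is `≥ c = κ u^{-5/4}`;
hence `Σ_S g ≥ Σ_B g ≥ #B · c ≥ (u/(2δ) - 1) c ≥ (u/(4δ)) c` once `δ ≤ u/4`, and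
`(u/4) c = (κ/4) u^{-1/4} ≥ M` as soon as `u ≤ (κ/(4M))^4`, which the choice
`θ₁ = min (θ₀/4) ((κ/(4M))^4 / (2ρ₂))` guarantees.  Mathlib only (`Real.rpow`, `Finset` sums, `Int`
floor/ceil).
-/

noncomputable section

open scoped BigOperators Topology Classical
open Filter Set Metric

namespace Summit.CriticalPhenomena.SAWScalingLimit.Theorems.HexConjecture.RootLocality

/-! ### Real-power bookkeeping -/

/-- `u ^ (5/4) = u · u ^ (1/4)` for `0 < u`. [folklore] -/
theorem windowBlock_rpow_five_quarters {u : ℝ} (hu : 0 < u) : u ^ (5 / 4 : ℝ) = u * u ^ (1 / 4 : ℝ) := by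
  rw [show (5 / 4 : ℝ) = 1 + 1 / 4 by norm_num, Real.rpow_add hu, Real.rpow_one]

/-- `u ^ (1/4) ≤ c₀` once `0 ≤ u ≤ c₀ ^ 4` (`0 ≤ c₀`). [folklore] -/
theorem windowBlock_rpow_quarter_le {u c₀ : ℝ} (hc₀ : 0 ≤ c₀) (hu : 0 ≤ u) (h : u ≤ c₀ ^ 4) :
    u ^ (1 / 4 : ℝ) ≤ c₀ := by
  calc u ^ (1 / 4 : ℝ) ≤ (c₀ ^ 4) ^ (1 / 4 : ℝ) := Real.rpow_le_rpow hu h (by norm_num)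
    _ = c₀ := by
      rw [show (1 / 4 : ℝ) = ((4 : ℕ) : ℝ)⁻¹ by norm_num]
      exact Real.pow_rpow_inv_natCast hc₀ (by norm_num)

/-- **The block constant.**  With `u ≤ (κ/(4M))^4`, the constant lower bound `c = κ u^{-5/4}` of a block
term satisfies `(u/4) · c ≥ M`. [folklore] -/
theorem windowBlock_const_ge {κ M u : ℝ} (hκ : 0 < κ) (hM : 0 < M) (hu : 0 < u)
    (huc : u ≤ (κ / (4 * M)) ^ 4) : M ≤ u / 4 * (κ * u ^ (-(5 / 4 : ℝ))) := by
  have h14 : u ^ (1 / 4 : ℝ) ≤ κ / (4 * M) := windowBlock_rpow_quarter_le (by positivity) hu.le huc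
  have h14pos : 0 < u ^ (1 / 4 : ℝ) := Real.rpow_pos_of_pos hu _
  have hneg : u ^ (-(5 / 4 : ℝ)) = (u * u ^ (1 / 4 : ℝ))⁻¹ := by
    rw [Real.rpow_neg hu.le, windowBlock_rpow_five_quarters hu]
  have hrew : u / 4 * (κ * u ^ (-(5 / 4 : ℝ))) = κ / 4 * (u ^ (1 / 4 : ℝ))⁻¹ := by
    rw [hneg]; field_simp
  rw [hrew]
  calc M = κ / 4 * (κ / (4 * M))⁻¹ := by field_simp
    _ ≤ κ / 4 * (u ^ (1 / 4 : ℝ))⁻¹ :=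
      mul_le_mul_of_nonneg_left (inv_anti₀ h14pos h14) (by positivity)

/-- **A block term.**  For `0 < δ d ≤ u` the term `κ (δ d)^{-5/4}` is at least `κ u^{-5/4}`. [folklore] -/
theorem windowBlock_const_le_term {κ u t : ℝ} (hκ : 0 ≤ κ) (ht : 0 < t) (htu : t ≤ u) :
    κ * u ^ (-(5 / 4 : ℝ)) ≤ κ * t ^ (-(5 / 4 : ℝ)) :=
  mul_le_mul_of_nonneg_left (Real.rpow_le_rpow_of_nonpos ht htu (by norm_num)) hκ

/-- **Lattice points of the block.**  `#(Icc ⌈θ₁R⌉ ⌊2θ₁R⌋) ≥ θ₁R - 1`. [folklore] -/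
theorem windowBlock_sub_one_le_card (θ₁ R : ℝ) :
    θ₁ * R - 1 ≤ ((Finset.Icc ⌈θ₁ * R⌉ ⌊2 * θ₁ * R⌋).card : ℝ) := by
  have h1 : ((⌊2 * θ₁ * R⌋ + 1 - ⌈θ₁ * R⌉ : ℤ) : ℝ) ≤
      ((Finset.Icc ⌈θ₁ * R⌉ ⌊2 * θ₁ * R⌋).card : ℝ) := by
    have : (⌊2 * θ₁ * R⌋ + 1 - ⌈θ₁ * R⌉ : ℤ) ≤ ((Finset.Icc ⌈θ₁ * R⌉ ⌊2 * θ₁ * R⌋).card : ℤ) := by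
      rw [Int.card_Icc]; exact Int.self_le_toNat _
    exact_mod_cast this
  have h2 := Int.lt_floor_add_one (2 * θ₁ * R)
  have h3 := Int.ceil_lt_add_one (θ₁ * R)
  push_cast at h1
  nlinarith

/-! ### The block sum -/

/-- **ONE DYADIC BLOCK OF THE WINDOW CARRIES `M/δ`.**  For `κ, ρ₂, θ₀, M > 0` there is `θ₁ > 0` with
`2θ₁ < θ₀` such that eventually along `δ → 0⁺`: for every finite `S ⊇ {d ∈ ℤ : θ₁ρ₂/δ ≤ d ≤ 2θ₁ρ₂/δ}` and
every `g : ℤ → ℝ`, nonnegative on `S` and `≥ κ (δ d)^{-5/4}` on the block, `M/δ ≤ Σ_{d ∈ S} g d`.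
See the module docstring for the proof. [folklore] -/
theorem window_block_sum_ge (κ ρ₂ θ₀ M : ℝ) (hκ : 0 < κ) (hρ₂ : 0 < ρ₂) (hθ₀ : 0 < θ₀) (hM : 0 < M) :
    ∃ θ₁ : ℝ, 0 < θ₁ ∧ 2 * θ₁ < θ₀ ∧ ∀ᶠ δ : ℝ in 𝓝[>] 0, ∀ S : Finset ℤ,
      (∀ d : ℤ, (θ₁ * (ρ₂ / δ) ≤ (d : ℝ) ∧ (d : ℝ) ≤ 2 * θ₁ * (ρ₂ / δ)) → d ∈ S) →
      ∀ g : ℤ → ℝ, (∀ d ∈ S, 0 ≤ g d) →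
      (∀ d ∈ S, θ₁ * (ρ₂ / δ) ≤ (d : ℝ) → (d : ℝ) ≤ 2 * θ₁ * (ρ₂ / δ) →
        κ * (δ * d) ^ (-(5 / 4 : ℝ)) ≤ g d) →
      M / δ ≤ ∑ d ∈ S, g d := by
  -- the window parameter `θ₁` and the block scale `u = 2 θ₁ ρ₂ ≤ (κ/(4M))^4`
  set c₀ : ℝ := κ / (4 * M) with hc₀
  have hc₀pos : 0 < c₀ := by positivity
  set θ₁ : ℝ := min (θ₀ / 4) (c₀ ^ 4 / (2 * ρ₂)) with hθ₁def
  have hθ₁ : 0 < θ₁ := lt_min (by positivity) (by positivity)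
  have hθ₁θ₀ : 2 * θ₁ < θ₀ := by
    have : θ₁ ≤ θ₀ / 4 := min_le_left _ _
    linarith
  set u : ℝ := 2 * θ₁ * ρ₂ with hudef
  have hu : 0 < u := by positivity
  have huc₀ : u ≤ c₀ ^ 4 := by
    have h : θ₁ ≤ c₀ ^ 4 / (2 * ρ₂) := min_le_right _ _
    rw [le_div_iff₀ (by positivity)] at h
    rw [hudef]; linarith
  -- the constant lower bound of a block term
  set c : ℝ := κ * u ^ (-(5 / 4 : ℝ)) with hcdef
  have hc : 0 ≤ c := by positivity
  have hkey : M ≤ u / 4 * c := windowBlock_const_ge hκ hM hu huc₀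
  refine ⟨θ₁, hθ₁, hθ₁θ₀, ?_⟩
  have e1 : ∀ᶠ δ : ℝ in 𝓝[>] 0, δ ≤ u / 4 := mem_nhdsWithin_of_mem_nhds (Iic_mem_nhds (by positivity))
  filter_upwards [e1, self_mem_nhdsWithin] with δ hδu hδ S hS g hg0 hg
  have hδ0 : (0 : ℝ) < δ := hδ
  set R : ℝ := ρ₂ / δ with hRdef
  have hRpos : 0 < R := div_pos hρ₂ hδ0
  have hδR : δ * (2 * θ₁ * R) = u := by rw [hRdef, hudef]; field_simp
  have hθ₁R : θ₁ * R = u / (2 * δ) := by rw [hRdef, hudef]; field_simp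
  -- the block `B ⊆ S`
  set B : Finset ℤ := Finset.Icc ⌈θ₁ * R⌉ ⌊2 * θ₁ * R⌋ with hB
  have hBiff : ∀ d : ℤ, d ∈ B ↔ (θ₁ * R ≤ (d : ℝ) ∧ (d : ℝ) ≤ 2 * θ₁ * R) :=
    mem_window_iff θ₁ (2 * θ₁) R
  have hBS : B ⊆ S := fun d hd => hS d ((hBiff d).1 hd)
  -- each block term is at least `c`
  have hterm : ∀ d ∈ B, c ≤ g d := by
    intro d hd
    obtain ⟨hd1, hd2⟩ := (hBiff d).1 hd
    have hdpos : (0 : ℝ) < d := lt_of_lt_of_le (mul_pos hθ₁ hRpos) hd1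
    have hδd : 0 < δ * d := mul_pos hδ0 hdpos
    have hδdu : δ * d ≤ u := by
      have := mul_le_mul_of_nonneg_left hd2 hδ0.le
      linarith
    exact (windowBlock_const_le_term hκ.le hδd hδdu).trans (hg d (hBS hd) hd1 hd2)
  -- counting and assembling
  have hcard : θ₁ * R - 1 ≤ (B.card : ℝ) := windowBlock_sub_one_le_card θ₁ R
  calc M / δ ≤ (θ₁ * R - 1) * c := by
        rw [div_le_iff₀ hδ0, hθ₁R]
        have hrew : (u / (2 * δ) - 1) * c * δ = (u / 2 - δ) * c := by
          field_simp
        rw [hrew]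
        calc M ≤ u / 4 * c := hkey
          _ ≤ (u / 2 - δ) * c := mul_le_mul_of_nonneg_right (by linarith) hc
    _ ≤ (B.card : ℝ) * c := mul_le_mul_of_nonneg_right hcard hc
    _ = B.card • c := (nsmul_eq_mul _ _).symm
    _ ≤ ∑ d ∈ B, g d := Finset.card_nsmul_le_sum B g c hterm
    _ ≤ ∑ d ∈ S, g d := Finset.sum_le_sum_of_subset_of_nonneg hBS fun d hd _ => hg0 d hd

/-! ### Registered form -/

/-- **Registered sub-goal `stub_windowBlockSumGe`** (crux item stmt-CriticalPhenomena-0808, line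
`root-locality-replaces-loewner`, lead continuation c6): one dyadic block of the floor window carries
`M/δ` (`window_block_sum_ge`), signature fully qualified. [folklore] -/
theorem stub_windowBlockSumGe : ∀ (κ ρ₂ θ₀ M : ℝ), 0 < κ → 0 < ρ₂ → 0 < θ₀ → 0 < M → ∃ θ₁ : ℝ, 0 < θ₁ ∧ 2 * θ₁ < θ₀ ∧ ∀ᶠ δ : ℝ in nhdsWithin 0 (Set.Ioi 0), ∀ S : Finset ℤ, (∀ d : ℤ, (θ₁ * (ρ₂ / δ) ≤ (d : ℝ) ∧ (d : ℝ) ≤ 2 * θ₁ * (ρ₂ / δ)) → d ∈ S) → ∀ g : ℤ → ℝ, (∀ d ∈ S, 0 ≤ g d) → (∀ d ∈ S, θ₁ * (ρ₂ / δ) ≤ (d : ℝ) → (d : ℝ) ≤ 2 * θ₁ * (ρ₂ / δ) → κ * (δ * d) ^ (-(5 / 4 : ℝ)) ≤ g d) → M / δ ≤ ∑ d ∈ S, g d :=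
  fun κ ρ₂ θ₀ M hκ hρ₂ hθ₀ hM => window_block_sum_ge κ ρ₂ θ₀ M hκ hρ₂ hθ₀ hM

end Summit.CriticalPhenomena.SAWScalingLimit.Theorems.HexConjecture.RootLocality

end
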